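import Mathlib
import HarnessLib
import Summits.Ventures.LatticeQCDFlow.Exactness.NCMCGeneralSpaceDoeblinPower
import Summits.Ventures.LatticeQCDFlow.Exactness.NCMCGeneralSpaceMarkovHarmonic

/-!
# A kernel with a Doeblin power forgets its start: almost-sure statements of the stationary chain hold from EVERY initial point

HONEST FRAMING: exact (Metropolis-corrected) sampling algorithms for lattice gauge theory;
figures of merit are autocorrelation/cost numbers at stated couplings and volumes; no
continuum-physics claim.

Venture `LatticeQCDFlow` (cell pub-lqcd), topic `Exactness`; FANOUT row 13 (`eng-snf`, GEN-18).
NEW WORK of the cell (a textbook Liouville argument typed against Mathlib's Ionescu-Tulcea chain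
`Kernel.trajMeasure`), not a published result; no definition is introduced; nothing is cited as a
fact.  Printed counterpart, NAMED ONLY: bounded harmonic functions of a uniformly ergodic kernel are
constant (Meyn–Tweedie 1993 §17.1; Revuz 1984 Ch. 6).

WHY.  GEN-17 removed the exceptional null set of starts for INDEPENDENCE samplers only
(`IMHErgodicEveryStart.lean`: one kernel step regenerates from the proposal); the NCMC and tempered
lanes of `latflow-snf` kept "for almost every initial configuration"
(`NCMCGeneralSpaceOccupancyChainStart.lean`) because their kernels have no state-independent
proposal.  A Doeblin minorisation of SOME POWER of the kernel is enough — and that is what the NCMC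
iteration kernel has (`NCMCGeneralSpaceOccupancyChainDoeblin.lean`: its square) and what the
tempered lane has (one step, `NCMCGeneralSpaceTemperedErgodic.lean`).

## Content (`κ` Markov on `S`; `π` an invariant probability law; `ε • ν ≤ (nHit κ m)(z, ·)` for
## every `z`, `ν` a probability law, `ε ≠ 0`)

* §1 `trajMeasure_dirac_eq_lintegral_nHit_of_shift_invariant` — ITERATED HARMONICITY: for a
  measurable shift-invariant event `A`, `P_{δ_z}(A) = ∫ P_{δ_y}(A) κⁿ(z, dy)` for every `n`, `z`
  (GEN-17's one-step `trajMeasure_dirac_eq_lintegral_of_shift_invariant` + Chapman–Kolmogorov);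
  `smul_le_of_nHit_minorised` (`ε ν ≤ π`: integrate the minorisation against `π`),
  `absolutelyContinuous_of_nHit_minorised` (`ν ≪ π`).
* §2 **`trajMeasure_dirac_eq_one_of_nHit_minorised`** — THE LIOUVILLE STEP: if `P_π(A) = 1` then
  `P_{δ_z}(A) = 1` for EVERY `z`.  (`h(z) = P_{δ_z}(A)` is `κ^m`-harmonic, `= 1` `π`-a.e. hence
  `ν`-a.e.; with `δ = sup_z (1 − h(z))`, one skeleton step gives `1 − h(z) ≤ (1 − ε) δ`, so
  `δ ≤ (1 − ε) δ`, `δ = 0`.)  `trajMeasure_eq_one_of_nHit_minorised` — the same from every initial LAW.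
* §3 **`tendsto_sum_div_everyStart_of_nHit_minorised`** — for every measurable `φ ∈ L¹(π)` and EVERY
  start `z`: `P_{δ_z}`-a.s. `(1/n) Σ_{i<n} φ(x_i) → ∫ φ dπ` (ergodicity of the stationary chain from
  `NCMCGeneralSpaceDoeblinPower.ergodic_shift_chain_of_nHit_minorised`, GEN-16's Birkhoff transfer
  `tendsto_sum_div_ae_chain`, then §2); `tendsto_sum_div_anyLaw_of_nHit_minorised` (every initial law).

NOT CLAIMED: rates for the non-stationary chain beyond `NCMCGeneralSpaceDoeblinPower` (certified
burn-in); Harris recurrence in general; unbounded `φ` beyond `L¹(π)`.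
-/

namespace Summit.Ventures.LatticeQCDFlow.Exactness.GeneralNCMC

open MeasureTheory ProbabilityTheory Set Filter Finset
open scoped ENNReal Topology

variable {S : Type*} [MeasurableSpace S] (κ : Kernel S S) [IsMarkovKernel κ]

/-! ## §1 Iterated harmonicity; the minorising law lies below the invariant law -/

section Harmonic

/-- **Iterated harmonicity**: for a measurable shift-invariant event `A`, the hitting probability
`h_A(z) = P_{δ_z}(A)` satisfies `h_A(z) = ∫ h_A dκⁿ(z, ·)` for every `n` and every `z`. -/
theorem trajMeasure_dirac_eq_lintegral_nHit_of_shift_invariant {A : Set (ℕ → S)}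
    (hA : MeasurableSet A) (hinv : (fun (x : ℕ → S) (k : ℕ) => x (k + 1)) ⁻¹' A = A) :
    ∀ (n : ℕ) (z : S),
      Kernel.trajMeasure (X := fun _ : ℕ => S) (Measure.dirac z)
          (fun n : ℕ => κ.comap (fun h : (j : ↥(Finset.Iic n)) → S => h ⟨n, Finset.mem_Iic.2 le_rfl⟩)
            (measurable_pi_apply _)) A =
        ∫⁻ y, Kernel.trajMeasure (X := fun _ : ℕ => S) (Measure.dirac y)
          (fun n : ℕ => κ.comap (fun h : (j : ↥(Finset.Iic n)) → S => h ⟨n, Finset.mem_Iic.2 le_rfl⟩)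
            (measurable_pi_apply _)) A ∂(nHit κ n z)
  | 0, z => by
      rw [nHit_zero, Kernel.id_apply, lintegral_dirac' _ (measurable_trajMeasure_dirac κ hA)]
  | n + 1, z => by
      rw [nHit_succ, Kernel.lintegral_comp _ _ _ (measurable_trajMeasure_dirac κ hA)]
      have hstep : ∀ y, ∫⁻ y', Kernel.trajMeasure (X := fun _ : ℕ => S) (Measure.dirac y')
          (fun n : ℕ => κ.comap (fun h : (j : ↥(Finset.Iic n)) → S => h ⟨n, Finset.mem_Iic.2 le_rfl⟩)
            (measurable_pi_apply _)) A ∂(κ y) =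
          Kernel.trajMeasure (X := fun _ : ℕ => S) (Measure.dirac y)
          (fun n : ℕ => κ.comap (fun h : (j : ↥(Finset.Iic n)) → S => h ⟨n, Finset.mem_Iic.2 le_rfl⟩)
            (measurable_pi_apply _)) A := fun y =>
        (trajMeasure_dirac_eq_lintegral_of_shift_invariant κ hA hinv y).symm
      simp_rw [hstep]
      exact trajMeasure_dirac_eq_lintegral_nHit_of_shift_invariant hA hinv n z

variable {κ} {π : Measure S} [IsProbabilityMeasure π] {m : ℕ} {ε : ℝ≥0∞} {ν : Measure S}

omit [IsMarkovKernel κ] in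
/-- **The minorising law of a power lies below the invariant law**: `ε ν ≤ π` (integrate
`ε ν ≤ κ^m(z, ·)` against `π`, which `κ^m` leaves invariant). -/
theorem smul_le_of_nHit_minorised (hπ : Kernel.Invariant κ π) (hmin : ∀ z, ε • ν ≤ nHit κ m z) :
    ε • ν ≤ π := by
  have hK : Kernel.Invariant (nHit κ m) π := invariant_nHit hπ m
  refine Measure.le_iff.2 fun B hB => ?_
  calc (ε • ν) B = ∫⁻ _, (ε • ν) B ∂π := by rw [lintegral_const, measure_univ, mul_one]
    _ ≤ ∫⁻ z, nHit κ m z B ∂π := lintegral_mono fun z => Measure.le_iff'.1 (hmin z) B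
    _ = π B := by rw [← Measure.bind_apply hB (Kernel.aemeasurable _), hK.def]

omit [IsMarkovKernel κ] in
/-- Hence the minorising law is absolutely continuous with respect to the invariant law. -/
theorem absolutelyContinuous_of_nHit_minorised (hπ : Kernel.Invariant κ π) (hε : ε ≠ 0)
    (hmin : ∀ z, ε • ν ≤ nHit κ m z) : ν ≪ π := by
  refine Measure.AbsolutelyContinuous.mk fun B hB hB0 => ?_
  have h := Measure.le_iff'.1 (smul_le_of_nHit_minorised hπ hmin) B
  rw [hB0, Measure.smul_apply, smul_eq_mul, le_zero_iff, mul_eq_zero] at h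
  exact h.resolve_left hε

end Harmonic

/-! ## §2 The Liouville step: almost sure from `π` ⇒ sure from every point -/

section Liouville

variable {κ} {π : Measure S} [IsProbabilityMeasure π] {m : ℕ} {ε : ℝ≥0∞} {ν : Measure S}
  [IsProbabilityMeasure ν]

/-- **A SHIFT-INVARIANT EVENT THAT IS ALMOST SURE FROM `π` IS SURE FROM EVERY START**, as soon as
some power of the kernel is Doeblin-minorised: `ε • ν ≤ κ^m(z, ·)` for all `z` (`ε ≠ 0`, `ν` a
probability law), `π` invariant, `A` measurable with `θ⁻¹A = A` and `P_π(A) = 1` ⇒ `P_{δ_z}(A) = 1`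
for EVERY `z`. -/
theorem trajMeasure_dirac_eq_one_of_nHit_minorised (hπ : Kernel.Invariant κ π) (hε : ε ≠ 0)
    (hmin : ∀ z, ε • ν ≤ nHit κ m z) {A : Set (ℕ → S)} (hA : MeasurableSet A)
    (hinv : (fun (x : ℕ → S) (k : ℕ) => x (k + 1)) ⁻¹' A = A)
    (hπA : Kernel.trajMeasure (X := fun _ : ℕ => S) π
      (fun n : ℕ => κ.comap (fun h : (j : ↥(Finset.Iic n)) → S => h ⟨n, Finset.mem_Iic.2 le_rfl⟩)
        (measurable_pi_apply _)) A = 1) (z : S) :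
    Kernel.trajMeasure (X := fun _ : ℕ => S) (Measure.dirac z)
      (fun n : ℕ => κ.comap (fun h : (j : ↥(Finset.Iic n)) → S => h ⟨n, Finset.mem_Iic.2 le_rfl⟩)
        (measurable_pi_apply _)) A = 1 := by
  haveI := isMarkovKernel_nHit κ m
  set H : S → ℝ≥0∞ := fun y => Kernel.trajMeasure (X := fun _ : ℕ => S) (Measure.dirac y)
    (fun n : ℕ => κ.comap (fun h : (j : ↥(Finset.Iic n)) → S => h ⟨n, Finset.mem_Iic.2 le_rfl⟩)
      (measurable_pi_apply _)) A with hH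
  have hHm : Measurable H := measurable_trajMeasure_dirac κ hA
  have hH1 : ∀ y, H y ≤ 1 := fun y => prob_le_one
  have hε1 : ε ≤ 1 := by
    haveI : Nonempty S := ⟨z⟩
    exact eps_le_one_of_minorised hmin
  have hεtop : ε ≠ ∞ := ne_top_of_le_ne_top ENNReal.one_ne_top hε1
  -- harmonicity for the skeleton kernel
  have hharm : ∀ y, H y = ∫⁻ y', H y' ∂(nHit κ m y) := fun y =>
    trajMeasure_dirac_eq_lintegral_nHit_of_shift_invariant κ hA hinv m y
  -- `H = 1` `π`-a.e., hence `ν`-a.e.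
  have hae : ∀ᵐ y ∂ν, H y = 1 :=
    (absolutelyContinuous_of_nHit_minorised hπ hε hmin).ae_le
      (trajMeasure_dirac_ae_eq_one_of_eq_one κ hA hπA)
  -- the defect `1 − H` and its supremum
  set δ : ℝ≥0∞ := ⨆ y, (1 - H y) with hδ
  have hδ1 : δ ≤ 1 := iSup_le fun y => tsub_le_self
  have hδtop : δ ≠ ∞ := ne_top_of_le_ne_top ENNReal.one_ne_top hδ1
  have hGle : ∀ y, 1 - H y ≤ δ := fun y => le_iSup (fun y => 1 - H y) y
  have hGm : Measurable fun y => 1 - H y := measurable_const.sub hHm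
  -- one skeleton step: `ε δ + (1 − H z') ≤ δ` for every `z'`
  have hstep : ∀ z', 1 - H z' ≤ δ - ε * δ := fun z' => by
    -- `∫ (δ − (1 − H)) d(ε ν) ≤ ∫ (δ − (1 − H)) dκ^m(z', ·)`
    have hmono : ∫⁻ y, (δ - (1 - H y)) ∂(ε • ν) ≤ ∫⁻ y, (δ - (1 - H y)) ∂(nHit κ m z') :=
      lintegral_mono' (hmin z') le_rfl
    have hlhs : ∫⁻ y, (δ - (1 - H y)) ∂(ε • ν) = ε * δ := by
      rw [lintegral_smul_measure, smul_eq_mul]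
      congr 1
      calc ∫⁻ y, (δ - (1 - H y)) ∂ν = ∫⁻ _, δ ∂ν :=
            lintegral_congr_ae (hae.mono fun y hy => by
              change δ - (1 - H y) = δ
              rw [hy, tsub_self, tsub_zero])
        _ = δ := by rw [lintegral_const, measure_univ, mul_one]
    have hfinG : ∫⁻ y, (1 - H y) ∂(nHit κ m z') ≠ ∞ := by
      refine ne_top_of_le_ne_top ENNReal.one_ne_top ?_
      calc ∫⁻ y, (1 - H y) ∂(nHit κ m z') ≤ ∫⁻ _, 1 ∂(nHit κ m z') :=
            lintegral_mono fun y => tsub_le_self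
        _ = 1 := by rw [lintegral_const, measure_univ, mul_one]
    have hfinH : ∫⁻ y, H y ∂(nHit κ m z') ≠ ∞ := by
      refine ne_top_of_le_ne_top ENNReal.one_ne_top ?_
      calc ∫⁻ y, H y ∂(nHit κ m z') ≤ ∫⁻ _, 1 ∂(nHit κ m z') := lintegral_mono fun y => hH1 y
        _ = 1 := by rw [lintegral_const, measure_univ, mul_one]
    have hrhs : ∫⁻ y, (δ - (1 - H y)) ∂(nHit κ m z') = δ - (1 - H z') := by
      rw [lintegral_sub hGm hfinG (Eventually.of_forall fun y => hGle y), lintegral_const,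
        measure_univ, mul_one, lintegral_sub hHm hfinH (Eventually.of_forall fun y => hH1 y),
        lintegral_const, measure_univ, mul_one, ← hharm z']
    rw [hlhs, hrhs] at hmono
    -- `ε δ ≤ δ − (1 − H z')` ⇒ `1 − H z' ≤ δ − ε δ`
    have hsum : ε * δ + (1 - H z') ≤ δ := add_le_of_le_tsub_right_of_le (hGle z') hmono
    exact ENNReal.le_sub_of_add_le_left (ENNReal.mul_ne_top hεtop hδtop) hsum
  -- hence `δ ≤ δ − ε δ`, so `δ = 0`
  have hδle : δ ≤ δ - ε * δ := iSup_le hstep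
  have hδ0 : δ = 0 := by
    by_contra hne
    have hεδ : ε * δ ≠ 0 := mul_ne_zero hε hne
    exact absurd hδle (not_le.2 (ENNReal.sub_lt_self hδtop hne hεδ))
  -- conclude at `z`
  have hz : 1 - H z = 0 := le_antisymm (hδ0 ▸ hGle z) bot_le
  exact le_antisymm (hH1 z) (tsub_eq_zero_iff_le.1 hz)

/-- **… and from every initial law** `μ₀`: `P_{μ₀}(A) = 1`. -/
theorem trajMeasure_eq_one_of_nHit_minorised (hπ : Kernel.Invariant κ π) (hε : ε ≠ 0)
    (hmin : ∀ z, ε • ν ≤ nHit κ m z) {A : Set (ℕ → S)} (hA : MeasurableSet A)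
    (hinv : (fun (x : ℕ → S) (k : ℕ) => x (k + 1)) ⁻¹' A = A)
    (hπA : Kernel.trajMeasure (X := fun _ : ℕ => S) π
      (fun n : ℕ => κ.comap (fun h : (j : ↥(Finset.Iic n)) → S => h ⟨n, Finset.mem_Iic.2 le_rfl⟩)
        (measurable_pi_apply _)) A = 1) (μ₀ : Measure S) [IsProbabilityMeasure μ₀] :
    Kernel.trajMeasure (X := fun _ : ℕ => S) μ₀
      (fun n : ℕ => κ.comap (fun h : (j : ↥(Finset.Iic n)) → S => h ⟨n, Finset.mem_Iic.2 le_rfl⟩)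
        (measurable_pi_apply _)) A = 1 := by
  rw [trajMeasure_apply_eq_lintegral_dirac κ μ₀ hA]
  simp_rw [trajMeasure_dirac_eq_one_of_nHit_minorised hπ hε hmin hA hinv hπA]
  rw [lintegral_const, measure_univ, mul_one]

end Liouville

/-! ## §3 Time averages converge from every start -/

section TimeAverages

variable {κ} {π : Measure S} [IsProbabilityMeasure π] {m : ℕ} {ε : ℝ≥0∞} {ν : Measure S}
  [IsProbabilityMeasure ν]

/-- **TIME AVERAGES CONVERGE FROM EVERY START under a Doeblin power.**  `π` invariant,
`ε • ν ≤ κ^m(z, ·)` for all `z` (`ε ≠ 0`): for every measurable `φ ∈ L¹(π)` and EVERY initial point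
`z`, along the chain started at `z`, `(1/n) Σ_{i<n} φ(x_i) → ∫ φ dπ` almost surely. -/
theorem tendsto_sum_div_everyStart_of_nHit_minorised (hπ : Kernel.Invariant κ π) (hε : ε ≠ 0)
    (hmin : ∀ z, ε • ν ≤ nHit κ m z) {φ : S → ℝ} (hφm : Measurable φ) (hφ : Integrable φ π)
    (z : S) :
    ∀ᵐ x ∂(Kernel.trajMeasure (X := fun _ : ℕ => S) (Measure.dirac z)
        (fun n : ℕ => κ.comap (fun h : (j : ↥(Finset.Iic n)) → S => h ⟨n, Finset.mem_Iic.2 le_rfl⟩)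
          (measurable_pi_apply _))),
      Tendsto (fun n : ℕ => (∑ i ∈ range n, φ (x i)) / n) atTop (𝓝 (∫ a, φ a ∂π)) := by
  have hA := measurableSet_cesaroSet (S := S) hφm (∫ a, φ a ∂π)
  have hinv := preimage_shift_cesaroSet (S := S) φ (∫ a, φ a ∂π)
  have hErg := ergodic_shift_chain_of_nHit_minorised (κ := κ) hπ hε
    (fun z t ht => minorised_setwise hmin z ht)
  have hπA : Kernel.trajMeasure (X := fun _ : ℕ => S) π
      (fun n : ℕ => κ.comap (fun h : (j : ↥(Finset.Iic n)) → S => h ⟨n, Finset.mem_Iic.2 le_rfl⟩)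
        (measurable_pi_apply _))
      {x : ℕ → S | Tendsto (fun n : ℕ => (∑ i ∈ range n, φ (x i)) / n) atTop (𝓝 (∫ a, φ a ∂π))}
      = 1 := by
    have h := tendsto_sum_div_ae_chain κ hErg hπ hφ
    rw [ae_iff, ← Set.compl_setOf] at h
    exact (prob_compl_eq_zero_iff hA).1 h
  have h1 := trajMeasure_dirac_eq_one_of_nHit_minorised hπ hε hmin hA hinv hπA z
  rw [ae_iff, ← Set.compl_setOf]
  exact (prob_compl_eq_zero_iff hA).2 h1

/-- **… and from every initial law** `μ₀`. -/
theorem tendsto_sum_div_anyLaw_of_nHit_minorised (hπ : Kernel.Invariant κ π) (hε : ε ≠ 0)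
    (hmin : ∀ z, ε • ν ≤ nHit κ m z) {φ : S → ℝ} (hφm : Measurable φ) (hφ : Integrable φ π)
    (μ₀ : Measure S) [IsProbabilityMeasure μ₀] :
    ∀ᵐ x ∂(Kernel.trajMeasure (X := fun _ : ℕ => S) μ₀
        (fun n : ℕ => κ.comap (fun h : (j : ↥(Finset.Iic n)) → S => h ⟨n, Finset.mem_Iic.2 le_rfl⟩)
          (measurable_pi_apply _))),
      Tendsto (fun n : ℕ => (∑ i ∈ range n, φ (x i)) / n) atTop (𝓝 (∫ a, φ a ∂π)) := by
  have hA := measurableSet_cesaroSet (S := S) hφm (∫ a, φ a ∂π)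
  have hinv := preimage_shift_cesaroSet (S := S) φ (∫ a, φ a ∂π)
  have hErg := ergodic_shift_chain_of_nHit_minorised (κ := κ) hπ hε
    (fun z t ht => minorised_setwise hmin z ht)
  have hπA : Kernel.trajMeasure (X := fun _ : ℕ => S) π
      (fun n : ℕ => κ.comap (fun h : (j : ↥(Finset.Iic n)) → S => h ⟨n, Finset.mem_Iic.2 le_rfl⟩)
        (measurable_pi_apply _))
      {x : ℕ → S | Tendsto (fun n : ℕ => (∑ i ∈ range n, φ (x i)) / n) atTop (𝓝 (∫ a, φ a ∂π))}
      = 1 := by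
    have h := tendsto_sum_div_ae_chain κ hErg hπ hφ
    rw [ae_iff, ← Set.compl_setOf] at h
    exact (prob_compl_eq_zero_iff hA).1 h
  have h1 := trajMeasure_eq_one_of_nHit_minorised hπ hε hmin hA hinv hπA μ₀
  rw [ae_iff, ← Set.compl_setOf]
  exact (prob_compl_eq_zero_iff hA).2 h1

end TimeAverages

end Summit.Ventures.LatticeQCDFlow.Exactness.GeneralNCMC
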